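import Literature.Computability.AlgebraicComplexity.LagrangeIndicator
import Literature.Computability.AlgebraicComplexity.KRSTDesign
import Literature.Computability.AlgebraicComplexity.BooleanGadgets
import HarnessLib

/-!
# KRST's bit gadgets: exponent vectors in binary, the degree indicator, and the algebraic
# selection of a Reed–Solomon block (Kumar–Ramya–Saptharishi–Tengse 2022, §3.1–3.3)

Topic `Computability/AlgebraicComplexity`. The `VNP`-succinctness of the Kabanets–Impagliazzo
generator on the permanent (KRST §3.4) writes the hitting polynomial
`Σ_{|μ| ≤ n} x^μ · Perm_[p](y|_{S_μ})` as a Boolean sum over the BITS `t` of the exponent vector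
`μ`. This file provides the polynomials in the bit variables `t_{i,k}` (`i < n`, `k < K`,
`μ_i = Σ_k t_{i,k} 2^k`) that KRST call `Mon`, `Sel` (§3.1 "Building monomials from exponent
vectors", §3.2 "Indexing combinatorial designs algebraically", Claim 10 / Observation 11 / 12):

* `decodeBits e i = Σ_k [e (i,k)] 2^k` (Batteries' `Nat.ofBits`), `encodeBits`, round trips;
* `bitSum F w = Σ_{i,k} w(i,k) · t_{i,k}` (a weighted bit sum; value `bitVal w e` at bits `e`);
* `degIndicator` — `[Σ_i μ_i ≤ n]` as a polynomial in the bits (Lagrange interpolation on the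
  integer range `[0, n·2^K]`, `LagrangeIndicator.lean`; this replaces KRST's degree truncation
  "by standard homogenisation arguments", §3.5, by an explicit indicator);
* `selPoly y j` — KRST's `Sel`: for a block position `j ∈ 𝔽_p` (a row of the universe
  `𝔽_p × 𝔽_p`) and a numeric seed `y : 𝔽_p × 𝔽_p → F`, the polynomial in the bits whose value at
  the bits of `μ` is `y(j, g_μ(j))`, the seed entry selected by the Reed–Solomon block of `μ`
  (`krstDesign`); built from the indicators `[R_j(t) ≡ c mod p]` of the integer
  `R_j(t) = Σ_{i,k} t_{i,k} 2^k (j^i mod p)` (KRST's `R_{i,a,p}` and `Q_{i,b,p}`), `eval_selPoly`;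
* size and degree bounds for all of them (`complexity_*_le`, `totalDegree_*_le`).

Everything is over a field of characteristic zero (the interpolation nodes are integers).

## References

* [KumarRamyaSaptharishiTengse2022] M. Kumar, C. Ramya, R. Saptharishi, A. Tengse, *If VNP is
  hard, then so are equations for it*, STACS 2022, §3.1 (Obs. 9), §3.2 (Claim 10, Obs. 11),
  §3.3 (Obs. 12).
-/

noncomputable section

namespace Literature.Computability.AlgebraicComplexity

open Literature.Barriers.ValiantsHypothesis MvPolynomial Finset CircuitArith BoolGadgets

/-! ### The coordinate set is finite -/

/-- The monomial set of the regime `d = n` is finite. [cite: KumarRamyaSaptharishiTengse2022, §3.4] -/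
instance degLEMonomials.instFinite (n : ℕ) : Finite (degLEMonomials n) :=
  (Finsupp.finite_of_degree_le (σ := Fin n) n).to_subtype

/-- A (noncomputable) enumeration of the `N = binom(2n, n)` coordinates `c_μ`, `deg μ ≤ n`.
[cite: KumarRamyaSaptharishiTengse2022, §3.4] -/
instance degLEMonomials.instFintype (n : ℕ) : Fintype (degLEMonomials n) :=
  Fintype.ofFinite _

/-- Crude count of the coordinates: `#degLEMonomials n ≤ (n+1)^n` (each of the `n` exponents is
`≤ n`; the exact count is `binom(2n, n)`). [cite: KumarRamyaSaptharishiTengse2022, §3.5] -/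
theorem card_degLEMonomials_le (n : ℕ) : Fintype.card (degLEMonomials n) ≤ (n + 1) ^ n := by
  classical
  have key : ∀ m : degLEMonomials n, ∀ i, (m : Fin n →₀ ℕ) i < n + 1 := fun m i =>
    Nat.lt_succ_of_le ((Finsupp.le_degree i (m : Fin n →₀ ℕ)).trans m.2)
  let φ : degLEMonomials n → (Fin n → Fin (n + 1)) := fun m i => ⟨(m : Fin n →₀ ℕ) i, key m i⟩
  have hφ : Function.Injective φ := by
    intro m m' h
    apply Subtype.ext
    ext i
    have := congrFun h i
    simpa [φ] using this
  calc Fintype.card (degLEMonomials n) ≤ Fintype.card (Fin n → Fin (n + 1)) :=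
        Fintype.card_le_of_injective φ hφ
    _ = (n + 1) ^ n := by simp

namespace KRSTSucc

/-! ### Exponent vectors in binary -/

section Bits

variable {n K : ℕ}

/-- The exponent vector encoded by the bits `e`: `μ_i = Σ_k [e (i,k)] 2^k`.
[cite: KumarRamyaSaptharishiTengse2022, Observation 9] -/
def decodeBits (e : Fin n × Fin K → Bool) (i : Fin n) : ℕ := Nat.ofBits fun k : Fin K => e (i, k)

/-- The bits of an exponent vector. [cite: KumarRamyaSaptharishiTengse2022, Observation 9] -/
def encodeBits (μ : Fin n → ℕ) (ik : Fin n × Fin K) : Bool := Nat.testBit (μ ik.1) ik.2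

/-- Decoding the bits of `μ` gives `μ` back when `μ_i < 2^K`. [cite: KumarRamyaSaptharishiTengse2022, Observation 9] -/
theorem decodeBits_encodeBits {μ : Fin n → ℕ} (hμ : ∀ i, μ i < 2 ^ K) :
    decodeBits (encodeBits μ : Fin n × Fin K → Bool) = μ := by
  funext i
  unfold decodeBits encodeBits
  simp only
  rw [Nat.ofBits_testBit, Nat.mod_eq_of_lt (hμ i)]

/-- Encoding the decoded vector gives the bits back. [cite: KumarRamyaSaptharishiTengse2022, Observation 9] -/
theorem encodeBits_decodeBits (e : Fin n × Fin K → Bool) : encodeBits (decodeBits e) = e := by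
  funext ⟨i, k⟩
  unfold decodeBits encodeBits
  simp

/-- Decoded exponents are `< 2^K`. [cite: KumarRamyaSaptharishiTengse2022, Observation 9] -/
theorem decodeBits_lt (e : Fin n × Fin K → Bool) (i : Fin n) : decodeBits e i < 2 ^ K :=
  Nat.ofBits_lt_two_pow _

/-- The value `Σ_{i,k} [e(i,k)] w(i,k)` of a weighted bit sum at the bits `e`. [folklore] -/
def bitVal (w : Fin n × Fin K → ℕ) (e : Fin n × Fin K → Bool) : ℕ :=
  ∑ ik : Fin n × Fin K, if e ik then w ik else 0

/-- `Σ_{i,k} [e(i,k)] 2^k ρ_i = Σ_i μ_i(e) ρ_i`. [cite: KumarRamyaSaptharishiTengse2022, Observation 9] -/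
theorem bitVal_two_pow_mul (ρ : Fin n → ℕ) (e : Fin n × Fin K → Bool) :
    bitVal (fun ik => 2 ^ (ik.2 : ℕ) * ρ ik.1) e = ∑ i : Fin n, decodeBits e i * ρ i := by
  unfold bitVal decodeBits
  rw [Fintype.sum_prod_type]
  refine Finset.sum_congr rfl fun i _ => ?_
  rw [ofBits_eq_sum, Finset.sum_mul]
  refine Finset.sum_congr rfl fun k _ => ?_
  cases e (i, k) <;> simp

/-- `Σ_{i,k} [e(i,k)] 2^k = Σ_i μ_i(e)`. [cite: KumarRamyaSaptharishiTengse2022, Observation 9] -/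
theorem bitVal_two_pow (e : Fin n × Fin K → Bool) :
    bitVal (fun ik => 2 ^ (ik.2 : ℕ)) e = ∑ i : Fin n, decodeBits e i := by
  have h := bitVal_two_pow_mul (fun _ => 1) e
  simp only [mul_one] at h
  exact h

/-- `Σ_i μ_i(e) ρ_i ≤ n 2^K R` when `ρ_i ≤ R` (the range bound of KRST's `R_{i,a,p}`).
[cite: KumarRamyaSaptharishiTengse2022, Observation 12] -/
theorem sum_decodeBits_mul_le {ρ : Fin n → ℕ} {R : ℕ} (hρ : ∀ i, ρ i ≤ R)
    (e : Fin n × Fin K → Bool) : ∑ i : Fin n, decodeBits e i * ρ i ≤ n * 2 ^ K * R := by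
  calc ∑ i : Fin n, decodeBits e i * ρ i ≤ ∑ _i : Fin n, 2 ^ K * R :=
        Finset.sum_le_sum fun i _ => Nat.mul_le_mul (decodeBits_lt e i).le (hρ i)
    _ = n * 2 ^ K * R := by rw [Finset.sum_const, Finset.card_univ, Fintype.card_fin, smul_eq_mul, mul_assoc]

end Bits

/-! ### Weighted bit sums as polynomials -/

section BitSum

variable (F : Type*) [Field F] {n K : ℕ}

/-- The Boolean point of `F^{n × K}` with coordinates `[e(i,k)] ∈ {0,1}`. [folklore] -/
def bitPt (e : Fin n × Fin K → Bool) : Fin n × Fin K → F := fun ik => toK F (e ik)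

/-- The weighted bit sum `Σ_{i,k} w(i,k) · t_{i,k}` (a linear form in the bit variables).
[cite: KumarRamyaSaptharishiTengse2022, §3.3 (the polynomial `R_{i,a,p}`)] -/
def bitSum (w : Fin n × Fin K → ℕ) : MvPolynomial (Fin n × Fin K) F :=
  ∑ ik : Fin n × Fin K, C (w ik : F) * X ik

/-- Its value at Boolean points is the integer `bitVal w e`. [cite: KumarRamyaSaptharishiTengse2022, §3.3] -/
theorem eval_bitSum (w : Fin n × Fin K → ℕ) (e : Fin n × Fin K → Bool) :
    eval (bitPt F e) (bitSum F w) = (bitVal w e : F) := by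
  unfold bitSum bitVal bitPt
  rw [eval_sum, Nat.cast_sum]
  refine Finset.sum_congr rfl fun ik _ => ?_
  rw [eval_mul, eval_C, eval_X]
  cases e ik <;> simp [toK]

/-- `L(bitSum) ≤ 2 n K`. [cite: KumarRamyaSaptharishiTengse2022, §3.3] -/
theorem complexity_bitSum_le (w : Fin n × Fin K → ℕ) : complexity (bitSum F w) ≤ 2 * (n * K) := by
  unfold bitSum
  refine (complexity_finset_sum_le _ _).trans ?_
  have h : ∀ ik : Fin n × Fin K, complexity (C (w ik : F) * X ik : MvPolynomial (Fin n × Fin K) F) ≤ 1 :=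
    fun ik => (complexity_mul_le_holds _ _).trans (by
      rw [complexity_C_holds, complexity_X_holds])
  calc ∑ ik, complexity (C (w ik : F) * X ik : MvPolynomial (Fin n × Fin K) F) + (univ : Finset (Fin n × Fin K)).card
      ≤ ∑ _ik : Fin n × Fin K, 1 + (univ : Finset (Fin n × Fin K)).card := by gcongr with ik; exact h ik
    _ = 2 * (n * K) := by simp [Finset.card_univ]; ring

/-- `deg(bitSum) ≤ 1`. [cite: KumarRamyaSaptharishiTengse2022, §3.3] -/
theorem totalDegree_bitSum_le (w : Fin n × Fin K → ℕ) : (bitSum F w).totalDegree ≤ 1 := by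
  unfold bitSum
  refine (totalDegree_finsetSum _ _).trans (Finset.sup_le fun ik _ => ?_)
  refine (totalDegree_mul _ _).trans ?_
  rw [totalDegree_C, zero_add]
  exact (isHomogeneous_X F ik).totalDegree_le

end BitSum

/-! ### The degree indicator `[Σ_i μ_i ≤ n]` -/

section DegIndicator

variable (F : Type*) [Field F] [CharZero F] (n K : ℕ)

/-- The indicator `[Σ_i μ_i(t) ≤ n]` of "the encoded exponent vector has degree `≤ n`", a
polynomial in the bits (Lagrange interpolation of `[· ≤ n]` on `[0, n·2^K]` at the bit sum
`Σ_{i,k} 2^k t_{i,k}`). [cite: KumarRamyaSaptharishiTengse2022, §3.5 (degree truncation)] -/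
def degIndicator : MvPolynomial (Fin n × Fin K) F :=
  natIndicatorAt (n * 2 ^ K * 1) (· ≤ n) (bitSum F fun ik : Fin n × Fin K => 2 ^ (ik.2 : ℕ) * 1)

variable {n K}

/-- Its value at the bits `e`: `[Σ_i μ_i(e) ≤ n]`. [cite: KumarRamyaSaptharishiTengse2022, §3.5] -/
theorem eval_degIndicator (e : Fin n × Fin K → Bool) :
    eval (bitPt F e) (degIndicator F n K) = if ∑ i : Fin n, decodeBits e i ≤ n then 1 else 0 := by
  unfold degIndicator
  rw [eval_natIndicatorAt (P := (· ≤ n)) (m := ∑ i : Fin n, decodeBits e i)]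
  · rw [eval_bitSum, bitVal_two_pow_mul (fun _ => 1) e]
    simp
  · have := sum_decodeBits_mul_le (ρ := fun _ : Fin n => 1) (R := 1) (fun _ => le_rfl) e
    simpa using this

omit [CharZero F] in
/-- Size: `≤ (n2^K+1)(2n2^K+2) + 2nK`. [cite: KumarRamyaSaptharishiTengse2022, Observation 11] -/
theorem complexity_degIndicator_le :
    complexity (degIndicator F n K) ≤ (n * 2 ^ K + 1) * (2 * (n * 2 ^ K) + 2) + 2 * (n * K) := by
  unfold degIndicator
  refine (complexity_natIndicatorAt_le _ _ _).trans ?_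
  rw [mul_one]
  exact Nat.add_le_add_left (complexity_bitSum_le F _) _

omit [CharZero F] in
/-- Degree: `≤ n 2^K`. [cite: KumarRamyaSaptharishiTengse2022, Observation 11] -/
theorem totalDegree_degIndicator_le : (degIndicator F n K).totalDegree ≤ n * 2 ^ K := by
  unfold degIndicator
  refine (totalDegree_natIndicatorAt_le _ _ _).trans ?_
  rw [mul_one]
  exact (Nat.mul_le_mul_left _ (totalDegree_bitSum_le F _)).trans (by rw [mul_one])

end DegIndicator

/-! ### Selecting the Reed–Solomon block algebraically (KRST `Sel`) -/

section Selection

variable (F : Type*) [Field F] [CharZero F] {n K : ℕ} {p : ℕ} [Fact p.Prime]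

/-- The points of `𝔽_p` enumerated by `Fin p` (as in `krstDesign`). [cite: KumarRamyaSaptharishiTengse2022, §3.3] -/
def pt (j : Fin p) : ZMod p := (ZMod.finEquiv p).toEquiv.toEmbedding j

/-- The residues `ρ_{i,j} = (j^i mod p) ∈ [0, p)` (KRST's `mod(i^j, p)`). [cite: KumarRamyaSaptharishiTengse2022, §3.3] -/
def rho (j : Fin p) (i : Fin n) : ℕ := ((pt j) ^ (i : ℕ)).val

omit [CharZero F] in
/-- `ρ_{i,j} < p`. [cite: KumarRamyaSaptharishiTengse2022, §3.3] -/
theorem rho_lt (j : Fin p) (i : Fin n) : rho j i < p := ZMod.val_lt _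

/-- **KRST's selection polynomial `Sel`** for the block position `j` and the numeric seed `y`:
`Σ_{c ∈ 𝔽_p} [R_j(t) ≡ c (mod p)] · y(j, c)` with `R_j(t) = Σ_{i,k} t_{i,k} 2^k ρ_{i,j}` —
at the bits of `μ` it selects the seed entry `y(j, g_μ(j))` on the Reed–Solomon block of `μ`.
[cite: KumarRamyaSaptharishiTengse2022, Observation 12] -/
def selPoly (y : ZMod p × ZMod p → F) (j : Fin p) : MvPolynomial (Fin n × Fin K) F :=
  ∑ c : ZMod p, natIndicatorAt (n * 2 ^ K * p) (fun v : ℕ => (v : ZMod p) = c)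
      (bitSum F fun ik : Fin n × Fin K => 2 ^ (ik.2 : ℕ) * rho j ik.1) * C (y (pt j, c))

/-- The second coordinate of the Reed–Solomon block of `μ` at the row `j`: `g_μ(j) = Σ_i μ_i j^i`
in `𝔽_p`. [cite: KumarRamyaSaptharishiTengse2022, §3.3] -/
theorem krstDesign_apply (μ : degLEMonomials n) (j : Fin p) :
    krstDesign p n μ j = (pt j, ∑ i : Fin n, ((μ : Fin n →₀ ℕ) i : ZMod p) * pt j ^ (i : ℕ)) := by
  unfold krstDesign
  rw [Literature.Computability.MetaComplexity.polyBlock_apply]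
  refine Prod.ext rfl ?_
  simp only
  rw [Literature.Computability.MetaComplexity.eval_ofFn_eq_sum, Fin.sum_univ_castSucc]
  have hlast : expCoeffs p n μ (Fin.last n) = 0 := by simp [expCoeffs]
  rw [hlast, zero_mul, add_zero]
  refine Finset.sum_congr rfl fun i _ => ?_
  have hi : expCoeffs p n μ i.castSucc = ((μ : Fin n →₀ ℕ) i : ZMod p) := by
    simp [expCoeffs, i.isLt]
  rw [hi]
  rfl

/-- **Value of `Sel` at the bits of an exponent vector**: if the bits `e` decode to `μ`, then
`Sel_j(e) = y(S_μ(j))`, the seed entry on the Reed–Solomon block of `μ` at row `j`.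
[cite: KumarRamyaSaptharishiTengse2022, Observation 12] -/
theorem eval_selPoly (y : ZMod p × ZMod p → F) (j : Fin p) (e : Fin n × Fin K → Bool)
    (μ : degLEMonomials n) (hμ : ∀ i, decodeBits e i = (μ : Fin n →₀ ℕ) i) :
    eval (bitPt F e) (selPoly F y j) = y (krstDesign p n μ j) := by
  unfold selPoly
  rw [eval_sum]
  have hval : ∀ c : ZMod p, eval (bitPt F e)
      (natIndicatorAt (n * 2 ^ K * p) (fun v : ℕ => (v : ZMod p) = c)
        (bitSum F fun ik : Fin n × Fin K => 2 ^ (ik.2 : ℕ) * rho j ik.1)) =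
      if ((∑ i : Fin n, decodeBits e i * rho j i : ℕ) : ZMod p) = c then 1 else 0 := by
    intro c
    rw [eval_natIndicatorAt (P := fun v : ℕ => (v : ZMod p) = c)
      (m := ∑ i : Fin n, decodeBits e i * rho j i)]
    · rw [eval_bitSum, bitVal_two_pow_mul (rho j) e]
    · exact sum_decodeBits_mul_le (fun i => (rho_lt j i).le) e
  simp_rw [eval_mul, eval_C, hval]
  rw [Finset.sum_eq_single (((∑ i : Fin n, decodeBits e i * rho j i : ℕ) : ZMod p))]
  · rw [if_pos rfl, one_mul, krstDesign_apply]
    congr 2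
    push_cast
    refine Finset.sum_congr rfl fun i _ => ?_
    rw [hμ i]
    simp only [rho, ZMod.natCast_val, ZMod.cast_id', id_eq]
  · intro c _ hc
    rw [if_neg (Ne.symm hc), zero_mul]
  · intro h
    exact absurd (Finset.mem_univ _) h

omit [CharZero F] in
/-- Size of `Sel_j`: `≤ p ((B+1)(2B+2) + 2nK + 1) + p`, `B = n 2^K p`. [cite: KumarRamyaSaptharishiTengse2022, Observation 12] -/
theorem complexity_selPoly_le (y : ZMod p × ZMod p → F) (j : Fin p) :
    complexity (selPoly F y j : MvPolynomial (Fin n × Fin K) F) ≤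
      p * ((n * 2 ^ K * p + 1) * (2 * (n * 2 ^ K * p) + 2) + 2 * (n * K) + 1) + p := by
  unfold selPoly
  refine (complexity_finset_sum_le _ _).trans ?_
  have hc : (Finset.univ : Finset (ZMod p)).card = p := by
    rw [Finset.card_univ, ZMod.card]
  rw [hc]
  refine Nat.add_le_add_right ?_ _
  calc _ ≤ ∑ _c : ZMod p, ((n * 2 ^ K * p + 1) * (2 * (n * 2 ^ K * p) + 2) + 2 * (n * K) + 1) := by
        refine Finset.sum_le_sum fun c _ => ?_
        refine (complexity_mul_le_holds _ _).trans ?_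
        rw [complexity_C_holds, add_zero]
        exact Nat.add_le_add_right
          ((complexity_natIndicatorAt_le _ _ _).trans
            (Nat.add_le_add_left (complexity_bitSum_le F _) _)) _
    _ = p * ((n * 2 ^ K * p + 1) * (2 * (n * 2 ^ K * p) + 2) + 2 * (n * K) + 1) := by
        rw [Finset.sum_const, smul_eq_mul, hc]

omit [CharZero F] in
/-- Degree of `Sel_j`: `≤ n 2^K p`. [cite: KumarRamyaSaptharishiTengse2022, Observation 12] -/
theorem totalDegree_selPoly_le (y : ZMod p × ZMod p → F) (j : Fin p) :
    (selPoly F y j : MvPolynomial (Fin n × Fin K) F).totalDegree ≤ n * 2 ^ K * p := by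
  unfold selPoly
  refine (totalDegree_finsetSum _ _).trans (Finset.sup_le fun c _ => ?_)
  refine (totalDegree_mul _ _).trans ?_
  rw [totalDegree_C, add_zero]
  refine (totalDegree_natIndicatorAt_le _ _ _).trans ?_
  exact (Nat.mul_le_mul_left _ (totalDegree_bitSum_le F _)).trans (by rw [mul_one])

end Selection

end KRSTSucc

end Literature.Computability.AlgebraicComplexity

end
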